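import Literature.MathematicalPhysics.QuantumFieldTheory.TomboulisYaffeLoopBounds
import Literature.MathematicalPhysics.QuantumFieldTheory.TorusWilsonLoopRepGramBounds
import HarnessLib

/-!
# Crux `IR` (stmt-QuantumFields-19354), line `tension-ratio` (flux skeleton), stub `TYObservable` — part 1:
# Tomboulis–Yaffe reflection-positivity bounds for Wilson and Polyakov loops in an OBSERVABLE representation

Pooled prover `ym-ir-line-pool-p3` (gen 3).  Helper module for item `stmt-QuantumFields-19354` (`--supports`; it closes
nothing).  The tree file `Literature/…/TomboulisYaffeLoopBounds.lean` proves the first links of the Tomboulis–Yaffe chain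
(App. I (A1.3)–(A1.7)) for loops taken in the SAME representation `ρ` as the Wilson action.  The flux skeleton of line
`ym-ir7-tension-ratio` (`Cruxes/IR/Lines/ym_ir7_tension_ratio_flux.lean`, stub `TYObservable`) needs them for loops in an arbitrary
continuous PROBE representation `π : G →* M_M(ℂ)` under the Wilson measure of `ρ`; reflection positivity is a property of the
MEASURE, so the proofs are the tree's, with the observable unitarised through `CompactGroup.unitarize π` and the Gram
inequality of `TorusWilsonLoopRepGramBounds` (`gram_wilsonLoopRep_nonneg_even`, p592927) for the first doubling:

* `wilsonLoopRep_sq_le_double` — `⟨W^π_{h×w}⟩² ≤ ⟨W^π_{2h×w}⟩`, `0 ≤ ⟨W^π_{2h×w}⟩` (`h ≤ L/2`);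
* `wilsonLoopRep_half_sq_le_polyakovCorrelator` — `⟨W^π_{(L/2)×w}⟩² ≤ Re ⟨tr π(Π₀(0)) conj tr π(Π₀(w eⱼ))⟩`;
* `polyakovCorrelatorRep_normSq_le_double` — `|⟨tr π(Πⱼ(0)) conj tr π(Πⱼ(s e₀))⟩|² ≤ M² Re ⟨… (2s e₀)⟩ ≥ 0` (`s ≤ L/2`);
* `polyakovCorrelatorRep_swap` — exchange of the axes `0 ↔ j`.

Torus `(ℤ/L)ᵈ`, `L` even, any real `β`, compact `G`, continuous `ρ`, `π`.  Everything is proved; no new definitions; nothing here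
bears on the Yang–Mills mass gap.  [cite: TomboulisYaffe1985, App. I (A1.3)–(A1.7)]
-/

open MeasureTheory Finset Complex
open scoped ComplexOrder ComplexConjugate

noncomputable section

namespace Summit.QuantumFields.YangMills.Cruxes.IR.TensionRatio.FluxTY

open Literature.MathematicalPhysics.QuantumFieldTheory Literature.MathematicalPhysics.QuantumFieldTheory.TomboulisYaffe
open WilsonRP WilsonSiteRP Literature.RepresentationTheory.CompactGroups

variable {d L N M : ℕ} [NeZero d] [NeZero L] {G : Type*} [Group G] [TopologicalSpace G]
  [IsTopologicalGroup G] [CompactSpace G] [MeasurableSpace G] [BorelSpace G]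
  (ρ : G →* Matrix (Fin N) (Fin N) ℂ) (π : G →* Matrix (Fin M) (Fin M) ℂ)

/-! ## Plumbing: traces, lines, coordinates -/

section Plumbing

omit [NeZero d] [NeZero L] [MeasurableSpace G] [BorelSpace G] in
/-- `‖tr ρ(g)‖ ≤ N` for a continuous `N`-dimensional representation of a compact group. [folklore] -/
private theorem norm_trace_le (hπ : Continuous π) (g : G) : ‖(π g).trace‖ ≤ M := by
  rw [← CompactGroup.trace_unitarize π hπ, Matrix.trace]
  refine (norm_sum_le _ _).trans ?_
  calc ∑ k, ‖Matrix.diag (CompactGroup.unitarize π hπ g) k‖ ≤ ∑ _k : Fin M, (1 : ℝ) :=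
        Finset.sum_le_sum fun k _ => CompactGroup.norm_unitarize_apply_le_one π hπ g k k
    _ = M := by simp

omit [NeZero d] [NeZero L] [MeasurableSpace G] [BorelSpace G] in
/-- Rows of the unitarised representation are orthonormal: `∑_{i,l} σ(g)_{il} conj σ(g)_{il} = N`.
[folklore] -/
private theorem sum_unitarize_mul_conj_self (hπ : Continuous π) (g : G) :
    ∑ i, ∑ l, CompactGroup.unitarize π hπ g i l * conj (CompactGroup.unitarize π hπ g i l) = M := by
  rw [← WilsonLoopRP.trace_unitarize_mul_inv π hπ g g, mul_inv_cancel, map_one, Matrix.trace_one,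
    Fintype.card_fin]

omit [NeZero d] [NeZero L] in
/-- The value `n < L` of the residue `n`. [folklore] -/
private theorem val_natCast_of_lt {n : ℕ} (hn : n < L) : ((n : ℕ) : ZMod L).val = n := by
  rw [ZMod.val_natCast, Nat.mod_eq_of_lt hn]

omit [NeZero L] in
/-- Time coordinate of `x + s eⱼ` (`j ≠ 0`). [folklore] -/
private theorem apply_zero_add_single_of_ne' (x : Site d L) {j : Fin d} (hj : j ≠ 0) (s : ZMod L) :
    (x + Pi.single j s : Site d L) 0 = x 0 := by
  simp [Pi.single_eq_of_ne hj.symm]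

omit [NeZero L] in
/-- A site whose time coordinate `c` satisfies `c + c = 0` is fixed by `θ'`. [folklore] -/
private theorem negReflect_add_single_zero_of_two_mul (x : Site d L) (hx : x 0 = 0) {c : ZMod L}
    (hc : c + c = 0) : (x + Pi.single 0 c : Site d L).negReflect = x + Pi.single 0 c :=
  negReflect_of_two_mul (by simp [hx, hc])

omit [NeZero L] in
/-- `θ'(x + c e₀) = x - c e₀` for `x` in the time slice `0`. [folklore] -/
private theorem negReflect_add_single_zero (x : Site d L) (hx : x 0 = 0) (c : ZMod L) :
    (x + Pi.single 0 c : Site d L).negReflect = x + Pi.single 0 (-c) := by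
  funext k
  by_cases hk : k = 0
  · subst hk; simp [hx]
  · simp [negReflect_apply_of_ne _ hk, hk]

end Plumbing

/-! ## Doubling of Wilson loops in the time direction (TY (A1.3)) -/

section Doubling

/-- **Doubling a Wilson loop across a reflection plane** (Tomboulis–Yaffe 1985 App. I (A1.3):
`W_{1,1} ≤ W_{1,2}^{1/2}` and its iterates, from reflection positivity in the lattice hyperplane
containing one side of the loop): on the even torus, for any real `β`, a spatial direction `j ≠ 0`
and `h ≤ L/2`, the rectangular loops at the origin with `h` resp. `2h` steps in the time direction
`0` and `w` steps in direction `j` satisfy `0 ≤ ⟨W_{2h×w}⟩` and `⟨W_{h×w}⟩² ≤ ⟨W_{2h×w}⟩` (the `2×2`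
Gram matrix `[⟨W_{(a+b)×w}⟩]_{a,b ∈ {0,h}}` of the tree's `gram_wilsonLoop_nonneg_even` is positive
semidefinite and `W_{0×w} = 1`). [cite: TomboulisYaffe1985, App. I (A1.3)] -/
theorem wilsonLoopRep_sq_le_double (hL : Even L) (hρ : Continuous ρ) (hπ : Continuous π) (β : ℝ) {j : Fin d}
    (hj : j ≠ 0)
    (h w : ℕ) (hh : h ≤ L / 2) :
    0 ≤ wilsonExpectation ρ β (wilsonLoop π (0 : Site d L) 0 j (2 * h) w) ∧
    (wilsonExpectation ρ β (wilsonLoop π (0 : Site d L) 0 j h w)) ^ 2 ≤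
      wilsonExpectation ρ β (wilsonLoop π (0 : Site d L) 0 j (2 * h) w) := by
  -- `0 ≤ W(2h)`: the Gram sum over `S = {h}`
  have hnn : 0 ≤ wilsonExpectation ρ β (wilsonLoop π (0 : Site d L) 0 j (2 * h) w) := by
    have hg := gram_wilsonLoopRep_nonneg_even ρ π hL hρ β hπ hj w {h} (by simpa using hh) (fun _ => 1)
    simpa [two_mul] using hg
  refine ⟨hnn, ?_⟩
  rcases Nat.eq_zero_or_pos M with hN | hN
  · subst hN
    simp only [wilsonLoop, wilsonExpectation, Nat.cast_zero, inv_zero, zero_mul, integral_zero]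
    simp
  haveI := isProbabilityMeasure_wilsonMeasure (d := d) (L := L) ρ hρ β
  -- the trivial loop `W_{0×w} = 1`
  have hW0 : wilsonExpectation ρ β (wilsonLoop π (0 : Site d L) 0 j 0 w) = 1 := by
    have hhol : ∀ U : GaugeConfig d L G, rectangleHolonomy U (0 : Site d L) 0 j 0 w = 1 := fun U => by
      simp [rectangleHolonomy, lineHolonomy]
    have h0 : ∀ U : GaugeConfig d L G, wilsonLoop π (0 : Site d L) 0 j 0 w U = 1 := fun U => by
      rw [wilsonLoop, hhol, map_one, Matrix.trace_one, Fintype.card_fin]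
      simp [hN.ne']
    simp only [h0, wilsonExpectation, integral_const, probReal_univ, one_smul]
  rcases Nat.eq_zero_or_pos h with rfl | hpos
  · -- `h = 0`: both loops are trivial
    rw [mul_zero, hW0]; norm_num
  -- `h ≠ 0`: the Gram sum over `S = {0, h}` with coefficients `(-W(h), 1)`
  set Wh := wilsonExpectation ρ β (wilsonLoop π (0 : Site d L) 0 j h w) with hWh
  have h0h : (0 : ℕ) ≠ h := by omega
  have hg := gram_wilsonLoopRep_nonneg_even ρ π hL hρ β hπ hj w {0, h}
    (fun a ha => by
      simp only [Finset.mem_insert, Finset.mem_singleton] at ha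
      rcases ha with rfl | rfl <;> omega)
    (fun a => if a = 0 then -Wh else 1)
  rw [Finset.sum_pair h0h, Finset.sum_pair h0h, Finset.sum_pair h0h] at hg
  simp only [↓reduceIte, if_neg (Ne.symm h0h), zero_add, add_zero, hW0] at hg
  rw [← two_mul, ← hWh] at hg
  nlinarith [hg]

end Doubling

/-! ## The loop of time extent `L/2`: removing the legs in the reflection planes (TY (A1.6)) -/

section HalfLoop

/-- Trace of a product of four matrices as an iterated sum (grouped `(AB)(CD)`). [folklore] -/
private theorem trace_mul_mul_mul {n : Type*} [Fintype n] [DecidableEq n] (A B C D : Matrix n n ℂ) :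
    (A * B * C * D).trace = ∑ a, ∑ c, ∑ b, ∑ e, (A a b * B b c) * (C c e * D e a) := by
  rw [Matrix.mul_assoc (A * B) C D, Matrix.trace]
  simp only [Matrix.diag_apply, Matrix.mul_apply, Finset.sum_mul_sum]

/-- **The Wilson loop of time extent `L/2` is bounded by the Polyakov-loop two-point function**
(Tomboulis–Yaffe 1985 App. I (A1.6): both spatial legs of the `(L_t/2) × J` loop lie in the two
reflection planes; "we may consider the spacelike legs of our loop to be on the opposite side of the
planes of reflection from the timelike legs and apply reflection positivity … Applying the Schwarz
inequality for sums gives" the bound by `⟨∑ U_{ij}θ(U_{ij}) ∑ U'_{ij}θ(U'_{ij})⟩`, the two timelike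
legs closing up with their reflections into two Polyakov loops). Torus form, any real `β`, compact
`G`, continuous `ρ`, `L` even: for the loop at the origin with `L/2` steps in the time direction `0`
and `w` steps in direction `j ≠ 0`,
`⟨W_{(L/2)×w}⟩² ≤ Re ⟨tr ρ(Π₀(0)) · conj tr ρ(Π₀(w eⱼ))⟩`, `Π₀(x) = lineHolonomy U 0 L x` the Polyakov
loop through `x` in direction `0` (with normalised traces: `W² ≤ N² · G_w`).
[cite: TomboulisYaffe1985, App. I (A1.6)] -/
theorem wilsonLoopRep_half_sq_le_polyakovCorrelator (hL : Even L) (hρ : Continuous ρ) (hπ : Continuous π) (β : ℝ)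
    {j : Fin d} (hj : j ≠ 0) (w : ℕ) :
    (wilsonExpectation ρ β (wilsonLoop π (0 : Site d L) 0 j (L / 2) w)) ^ 2 ≤
      (wilsonExpectation ρ β fun U : GaugeConfig d L G =>
        (π (lineHolonomy U 0 L 0)).trace *
          conj ((π (lineHolonomy U 0 L ((0 : Site d L) + Pi.single j (w : ZMod L)))).trace)).re := by
  haveI : Fact (1 < L) := ⟨by obtain ⟨r, hr⟩ := hL; have := NeZero.ne L; omega⟩
  haveI := isProbabilityMeasure_wilsonMeasure (d := d) (L := L) ρ hρ β
  rcases Nat.eq_zero_or_pos M with hN | hN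
  · subst hN
    simp [wilsonLoop, wilsonExpectation]
  obtain ⟨r, hr⟩ := hL
  set m : ℕ := L / 2 with hm_def
  have hmr : m = r := by omega
  have hmL : m + m = L := by omega
  have hmlt : m < L := by have := NeZero.ne L; omega
  have hmm : ((m : ℕ) : ZMod L) + (m : ℕ) = 0 := by
    rw [← Nat.cast_add, hmL, ZMod.natCast_self]
  set σ := CompactGroup.unitarize π hπ with hσ_def
  have hσc : Continuous σ := CompactGroup.continuous_unitarize π hπ
  -- the sites and the four legs
  set xm : Site d L := (0 : Site d L) + Pi.single 0 ((m : ℕ) : ZMod L) with hxm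
  set xw : Site d L := (0 : Site d L) + Pi.single j ((w : ℕ) : ZMod L) with hxw
  have hxm0 : xm.negReflect = xm := negReflect_add_single_zero_of_two_mul 0 rfl hmm
  have hx00 : (0 : Site d L).negReflect = 0 := negReflect_of_two_mul (by simp)
  have hxw0 : xw 0 = 0 := by rw [hxw, apply_zero_add_single_of_ne' _ hj]; rfl
  -- Polyakov loops from the reflected time-like legs
  have hu : ∀ U : GaugeConfig d L G,
      lineHolonomy U 0 m 0 * (lineHolonomy U.negReflect 0 m 0)⁻¹ = lineHolonomy U 0 L 0 := by
    intro U
    rw [WilsonLoopRP.lineHolonomy_negReflect_zero, inv_inv, ← hxm, hxm0, hxm,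
      ← WilsonLoopRP.lineHolonomy_add U 0 m m 0, hmL]
  have hu' : ∀ U : GaugeConfig d L G,
      lineHolonomy U.negReflect 0 m xw * (lineHolonomy U 0 m xw)⁻¹ = (lineHolonomy U 0 L xw)⁻¹ := by
    intro U
    rw [WilsonLoopRP.lineHolonomy_negReflect_zero,
      negReflect_add_single_zero_of_two_mul xw hxw0 hmm, ← mul_inv_rev,
      ← WilsonLoopRP.lineHolonomy_add U 0 m m xw, hmL]
  -- the two families
  set Φ : (Fin M × Fin M) × (Fin M × Fin M) → GaugeConfig d L G → ℂ :=
    fun k U => conj (σ (lineHolonomy U j w xm) k.2.1 k.1.2) * σ (lineHolonomy U j w 0) k.1.1 k.2.2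
    with hΦ
  set Ψ : (Fin M × Fin M) × (Fin M × Fin M) → GaugeConfig d L G → ℂ :=
    fun k U => σ (lineHolonomy U 0 m 0) k.1.1 k.2.1 * conj (σ (lineHolonomy U 0 m xw) k.2.2 k.1.2)
    with hΨ
  -- reflection invariance of the spatial legs
  have hgθ : ∀ U : GaugeConfig d L G, lineHolonomy U.negReflect j w 0 = lineHolonomy U j w 0 :=
    fun U => by rw [WilsonLoopRP.lineHolonomy_negReflect_of_ne U hj, hx00]
  have hg'θ : ∀ U : GaugeConfig d L G, lineHolonomy U.negReflect j w xm = lineHolonomy U j w xm :=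
    fun U => by rw [WilsonLoopRP.lineHolonomy_negReflect_of_ne U hj, hxm0]
  have hΦθ : ∀ k U, Φ k (GaugeConfig.negReflect U) = Φ k U := fun k U => by
    simp only [hΦ, hgθ, hg'θ]
  -- admissibility
  have hE : ∀ e : Edge d L, IsSitePosEdge e ∨ IsSharedEdge e →
      e ∈ ((sitePosEdges ∪ sharedEdges : Finset (Edge d L)) : Set (Edge d L)) := fun e he => by
    rw [Finset.coe_union, Set.mem_union, Finset.mem_coe, Finset.mem_coe, mem_sitePosEdges,
      mem_sharedEdges]
    exact he
  have dep_time : ∀ (x : Site d L), x 0 = 0 → DependsOn (fun U : GaugeConfig d L G => lineHolonomy U 0 m x)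
      ((sitePosEdges ∪ sharedEdges : Finset (Edge d L)) : Set (Edge d L)) := by
    intro x hx U V hUV
    refine WilsonLoopRP.lineHolonomy_congr 0 m x fun s hs => hUV _ (hE _ (Or.inl ?_))
    unfold IsSitePosEdge
    dsimp only
    simp only [↓reduceIte, Pi.add_apply, hx, Pi.single_eq_same, zero_add]
    rw [val_natCast_of_lt (by omega)]
    omega
  have dep_space : ∀ (x : Site d L), (x 0 = 0 ∨ x 0 = ((m : ℕ) : ZMod L)) →
      DependsOn (fun U : GaugeConfig d L G => lineHolonomy U j w x)
      ((sitePosEdges ∪ sharedEdges : Finset (Edge d L)) : Set (Edge d L)) := by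
    intro x hx U V hUV
    refine WilsonLoopRP.lineHolonomy_congr j w x fun s hs => hUV _ (hE _ (Or.inr ?_))
    refine ⟨hj, ?_⟩
    dsimp only
    rw [apply_zero_add_single_of_ne' _ hj]
    rcases hx with hx | hx
    · left; rw [hx, ZMod.val_zero]
    · right; rw [hx, val_natCast_of_lt hmlt]
  have hΦobs : ∀ k, IsHalfObs (Φ k) := fun k => by
    refine ⟨?_, ⟨1, fun U => ?_⟩, fun U V hUV => ?_⟩
    · exact (Complex.continuous_conj.measurable.comp
        (WilsonLoopRP.entryMeasurable_lineHolonomy hσc j w xm _ _)).mul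
        (WilsonLoopRP.entryMeasurable_lineHolonomy hσc j w 0 _ _)
    · rw [hΦ, norm_mul, Complex.norm_conj]
      exact mul_le_one₀ (CompactGroup.norm_unitarize_apply_le_one π hπ _ _ _) (norm_nonneg _)
        (CompactGroup.norm_unitarize_apply_le_one π hπ _ _ _)
    · simp only [hΦ, dep_space xm (Or.inr (by simp [hxm])) hUV, dep_space (0 : Site d L) (Or.inl rfl) hUV]
  have hΨobs : ∀ k, IsHalfObs (Ψ k) := fun k => by
    refine ⟨?_, ⟨1, fun U => ?_⟩, fun U V hUV => ?_⟩
    · exact (WilsonLoopRP.entryMeasurable_lineHolonomy hσc 0 m 0 _ _).mul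
        (Complex.continuous_conj.measurable.comp
          (WilsonLoopRP.entryMeasurable_lineHolonomy hσc 0 m xw _ _))
    · rw [hΨ, norm_mul, Complex.norm_conj]
      exact mul_le_one₀ (CompactGroup.norm_unitarize_apply_le_one π hπ _ _ _) (norm_nonneg _)
        (CompactGroup.norm_unitarize_apply_le_one π hπ _ _ _)
    · simp only [hΨ, dep_time (0 : Site d L) rfl hUV, dep_time xw hxw0 hUV]
  -- (1) the cross term is the loop
  have hcross_pt : ∀ U : GaugeConfig d L G,
      ∑ k, conj (Φ k U.negReflect) * Ψ k U = (π (rectangleHolonomy U 0 0 j m w)).trace := by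
    intro U
    have hrect : rectangleHolonomy U 0 0 j m w =
        lineHolonomy U 0 m 0 * lineHolonomy U j w xm * (lineHolonomy U 0 m xw)⁻¹ *
          (lineHolonomy U j w 0)⁻¹ := rfl
    rw [hrect, ← CompactGroup.trace_unitarize π hπ, map_mul, map_mul, map_mul,
      CompactGroup.unitarize_inv, CompactGroup.unitarize_inv, trace_mul_mul_mul,
      Fintype.sum_prod_type]
    simp only [Fintype.sum_prod_type, hΦθ]
    refine Finset.sum_congr rfl fun a _ => Finset.sum_congr rfl fun c _ =>
      Finset.sum_congr rfl fun b _ => Finset.sum_congr rfl fun e _ => ?_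
    simp only [hΦ, hΨ, map_mul, Complex.conj_conj, Matrix.star_apply, Complex.star_def, hσ_def]
    ring
  have hcross : siteRPForm ρ β Φ Ψ =
      ∫ U : GaugeConfig d L G, (π (rectangleHolonomy U (0 : Site d L) 0 j m w)).trace
        ∂(wilsonMeasure ρ β) := by
    unfold siteRPForm
    rw [← integral_finsetSum _ fun k _ => integrable_conj_negReflect_mul ρ hρ β (hΦobs k) (hΨobs k)]
    exact integral_congr_ae (ae_of_all _ hcross_pt)
  have hcross_re : (siteRPForm ρ β Φ Ψ).re =
      M * wilsonExpectation ρ β (wilsonLoop π (0 : Site d L) 0 j m w) := by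
    rw [hcross]
    have hint : Integrable (fun U : GaugeConfig d L G => (π (rectangleHolonomy U 0 0 j m w)).trace)
        (wilsonMeasure ρ β) := by
      refine Integrable.of_bound ?_ M (ae_of_all _ fun U => norm_trace_le π hπ _)
      rw [show (fun U : GaugeConfig d L G => (π (rectangleHolonomy U 0 0 j m w)).trace) =
          fun U => (σ (rectangleHolonomy U 0 0 j m w)).trace by
        funext U; rw [hσ_def, CompactGroup.trace_unitarize]]
      exact (WilsonLoopRP.entryMeasurable_rectangleHolonomy π hπ _ _ _ _ _).measurable_trace.aestronglyMeasurable
    have := integral_re hint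
    simp only [RCLike.re_to_complex] at this
    rw [← this]
    unfold wilsonExpectation
    rw [← integral_const_mul]
    refine integral_congr_ae (ae_of_all _ fun U => ?_)
    exact WilsonLoopRP.re_trace_eq_mul_wilsonLoop π hN.ne' _ _ _ _ _ _
  -- (2) the `Φ` Gram entry is `N²`
  have hΦΦ_pt : ∀ U : GaugeConfig d L G, ∑ k, conj (Φ k U.negReflect) * Φ k U = (M : ℂ) * M := by
    intro U
    -- abbreviations for the two legs
    set B := σ (lineHolonomy U j w xm) with hB
    set D := σ (lineHolonomy U j w 0) with hD
    have hP : ∑ c, ∑ b, B b c * conj (B b c) = M := by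
      rw [Finset.sum_comm]; exact sum_unitarize_mul_conj_self π hπ _
    have hQ : ∑ a, ∑ e, D a e * conj (D a e) = M := sum_unitarize_mul_conj_self π hπ _
    simp only [hΦθ, Fintype.sum_prod_type]
    calc ∑ a, ∑ c, ∑ b, ∑ e, conj (Φ ((a, c), (b, e)) U) * Φ ((a, c), (b, e)) U
        = ∑ a, ∑ c, ∑ b, ∑ e, (B b c * conj (B b c)) * (D a e * conj (D a e)) := by
          refine Finset.sum_congr rfl fun a _ => Finset.sum_congr rfl fun c _ =>
            Finset.sum_congr rfl fun b _ => Finset.sum_congr rfl fun e _ => ?_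
          simp only [hΦ, hB, hD, map_mul, Complex.conj_conj]
          ring
      _ = ∑ a, (∑ c, ∑ b, B b c * conj (B b c)) * ∑ e, D a e * conj (D a e) := by
          simp only [Finset.sum_mul]; simp only [Finset.mul_sum]
      _ = (M : ℂ) * M := by rw [hP, ← Finset.mul_sum, hQ]
  have hΦΦ : (siteRPForm ρ β Φ Φ).re = (M : ℝ) * M := by
    unfold siteRPForm
    rw [← integral_finsetSum _ fun k _ => integrable_conj_negReflect_mul ρ hρ β (hΦobs k) (hΦobs k),
      integral_congr_ae (ae_of_all _ hΦΦ_pt), integral_const, probReal_univ, one_smul]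
    norm_cast
  -- (3) the `Ψ` Gram entry is the Polyakov-loop correlator
  have hΨΨ_pt : ∀ U : GaugeConfig d L G, ∑ k, conj (Ψ k U.negReflect) * Ψ k U =
      (π (lineHolonomy U 0 L 0)).trace * conj ((π (lineHolonomy U 0 L xw)).trace) := by
    intro U
    have h1 : (π (lineHolonomy U 0 L 0)).trace =
        ∑ a, ∑ b, σ (lineHolonomy U 0 m 0) a b * conj (σ (lineHolonomy U.negReflect 0 m 0) a b) := by
      rw [← hu U, ← CompactGroup.trace_unitarize π hπ, hσ_def, WilsonLoopRP.trace_unitarize_mul_inv]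
    have h2 : conj ((π (lineHolonomy U 0 L xw)).trace) =
        ∑ e, ∑ c, σ (lineHolonomy U.negReflect 0 m xw) e c * conj (σ (lineHolonomy U 0 m xw) e c) := by
      rw [← CompactGroup.trace_map_inv π hπ, ← hu' U, ← CompactGroup.trace_unitarize π hπ, hσ_def,
        WilsonLoopRP.trace_unitarize_mul_inv]
    rw [h1, h2]
    set A := σ (lineHolonomy U 0 m 0) with hA
    set A' := σ (lineHolonomy U.negReflect 0 m 0) with hA'
    set C := σ (lineHolonomy U 0 m xw) with hC
    set C' := σ (lineHolonomy U.negReflect 0 m xw) with hC'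
    simp only [Fintype.sum_prod_type]
    calc ∑ a, ∑ c, ∑ b, ∑ e, conj (Ψ ((a, c), (b, e)) U.negReflect) * Ψ ((a, c), (b, e)) U
        = ∑ a, ∑ c, ∑ b, ∑ e, (A a b * conj (A' a b)) * (C' e c * conj (C e c)) := by
          refine Finset.sum_congr rfl fun a _ => Finset.sum_congr rfl fun c _ =>
            Finset.sum_congr rfl fun b _ => Finset.sum_congr rfl fun e _ => ?_
          simp only [hΨ, hA, hA', hC, hC', map_mul, Complex.conj_conj]
          ring
      _ = ∑ a, ∑ b, ∑ e, ∑ c, (A a b * conj (A' a b)) * (C' e c * conj (C e c)) := by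
          refine Finset.sum_congr rfl fun a _ => ?_
          rw [Finset.sum_comm]
          exact Finset.sum_congr rfl fun b _ => Finset.sum_comm
      _ = (∑ a, ∑ b, A a b * conj (A' a b)) * ∑ e, ∑ c, C' e c * conj (C e c) := by
          simp only [Finset.sum_mul]; simp only [Finset.mul_sum]
  have hΨΨ : siteRPForm ρ β Ψ Ψ = wilsonExpectation ρ β (fun U : GaugeConfig d L G =>
      (π (lineHolonomy U 0 L 0)).trace * conj ((π (lineHolonomy U 0 L xw)).trace)) := by
    unfold siteRPForm wilsonExpectation
    rw [← integral_finsetSum _ fun k _ => integrable_conj_negReflect_mul ρ hρ β (hΨobs k) (hΨobs k)]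
    exact integral_congr_ae (ae_of_all _ hΨΨ_pt)
  -- (4) Cauchy–Schwarz
  have hCS := normSq_siteRPForm_le ρ ⟨r, hr⟩ hρ β hΦobs hΨobs
  rw [hΦΦ, hΨΨ] at hCS
  have hre : (siteRPForm ρ β Φ Ψ).re ^ 2 ≤ ‖siteRPForm ρ β Φ Ψ‖ ^ 2 :=
    sq_le_sq.2 (by rw [abs_norm]; exact Complex.abs_re_le_norm _)
  rw [hcross_re] at hre
  have hN2 : (0 : ℝ) < (M : ℝ) * M := by positivity
  have key := hre.trans hCS
  rw [mul_pow] at key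
  have : (wilsonExpectation ρ β (wilsonLoop π (0 : Site d L) 0 j m w)) ^ 2 ≤
      (wilsonExpectation ρ β fun U : GaugeConfig d L G =>
        (π (lineHolonomy U 0 L 0)).trace * conj ((π (lineHolonomy U 0 L xw)).trace)).re := by
    have h' : (M : ℝ) ^ 2 = (M : ℝ) * M := sq _
    rw [h'] at key
    exact le_of_mul_le_mul_left (by linarith [key]) hN2
  exact this

end HalfLoop

end Summit.QuantumFields.YangMills.Cruxes.IR.TensionRatio.FluxTY

end
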